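import Mathlib
import Summits.QuantumFields.YangMills.Theorems.CurvatureSandwichBound.Negative.Unbundled
import Summits.QuantumFields.YangMills.Theorems.IsotropyFromPowerCountingCurvatureSandwichBoundChainEngine
import HarnessLib

/-!
# Stub `stub_tiltedChainReading` for the crux `CurvatureSandwichBound` (line `Sketch`)

Model-blind bookkeeping for the frame transfer of the multiple-reflection chain (crux
stmt-QuantumFields-18372, registered skeleton `Cruxes/CurvatureSandwichBound/Lines/Sketch.lean`).

`R` is the quarter-turn frame of the `(x₀, x₁)`-plane (`(Rx)₀ = (x₀ + x₁)/√2`, `(Rx)₁ = (x₁ − x₀)/√2`),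
`M := θ ∘ R ∘ θ` its time-reflection conjugate, `P` the 45°-frame chain step
`P⟨m, Y⟩ = ⟨2 + m, T_{s e₀}(f₁† ⊗ f₁ ⊗ T_{s e₀} Y)⟩` and `Q` the tilted step
`Q⟨m, Y⟩ = ⟨2 + m, T_{s Re₀}(R·f₁† ⊗ R·f₁ ⊗ T_{s Re₀} Y)⟩` (`R·F := linActMulti R F`, `f₁† = osAdjoint f₁`).
For a strict cone chain `G` of the 45° frame (`|x₁| < x₀` and `|Δx₁| < Δx₀` on its support):

* `R·G` is `e₀`-time-ordered (slot times `(x₀ + x₁)/√2`), and so is `M·G` (slot times `(x₀ − x₁)/√2`);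
* `osAdjoint (M·G) = R·(osAdjoint G)` pointwise (`θθ = 1`);
* `R` intertwines the chain steps: `⟨(Pᴺx).1, R·(Pᴺx).2⟩ = Qᴺ⟨x.1, R·x.2⟩` (`R·T_a = T_{Ra}·R`,
  `R·(F ⊗ G) = R·F ⊗ R·G`), for every point `x` of `Σ m, 𝓢((ℝ⁴)^m)`;
* hence the 45°-frame chain moment with ends `G`, `G'` is an `e₀`-frame inner product,
  `𝔖(R·(ΘG* ⊗ (Pᴺ G').2)) = ⟪Ψ_{M·G}, Ψ_{(Qᴺ⟨m', R·G'⟩).2}⟫` (`inner_fieldVec_fieldVec`, `fieldVec_sigma_congr`).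

References: K. Osterwalder, R. Schrader, Comm. Math. Phys. 31 (1973) §2, §4.1; J. Glimm, A. Jaffe,
Quantum Physics (1987) §6.1, §10.5.
-/

noncomputable section

namespace Summit.QuantumFields.YangMills.Theorems.CurvatureSandwichBound.Sketch

open scoped BigOperators SchwartzMap InnerProductSpace ComplexConjugate
open MeasureTheory Filter Topology
open Literature.MathematicalPhysics.QuantumLattice Literature.MathematicalPhysics.AQFT
  Literature.MathematicalPhysics.QuantumFieldTheory Literature.Probability.LatticeModels
open Summit.QuantumFields.YangMills.Theorems.NPointIsotropy.Negative (E4)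
open Summit.QuantumFields.YangMills.Theorems.CurvatureSandwichBound.Negative (IsQuarterTurnFrame)

/-! ## Supports of rotated test functions -/

/-- Support of a diagonally rotated test function, in preimage form: if `x ∈ tsupport (L·F)` then
`(L⁻¹x₁, …, L⁻¹xₙ) ∈ tsupport F`. -/
theorem mem_tsupport_linActMulti {n : ℕ} (L : E4 ≃ₗᵢ[ℝ] E4) (F : 𝓢((Fin n → E4), ℂ))
    {x : Fin n → E4} (hx : x ∈ tsupport (linActMulti L F : (Fin n → E4) → ℂ)) :
    (fun k => L.symm (x k)) ∈ tsupport (F : (Fin n → E4) → ℂ) := by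
  have hc : Continuous fun (y : Fin n → E4) (k : Fin n) => L.symm (y k) :=
    continuous_pi fun k => L.symm.continuous.comp (continuous_apply k)
  refine closure_minimal (fun y hy => ?_) ((isClosed_tsupport _).preimage hc) hx
  rw [Function.mem_support, linActMulti_apply] at hy
  exact Set.mem_preimage.2 (subset_tsupport _ (Function.mem_support.2 hy))

/-! ## The quarter-turn frame and its time-reflection conjugate: slot times -/

/-- The time read in the quarter-turn frame: `x₀ = cos(π/4)·((R⁻¹x)₀ + (R⁻¹x)₁)`. -/
theorem quarterTurn_zero_eq {R : E4 ≃ₗᵢ[ℝ] E4} (hR : IsQuarterTurnFrame R) (z : E4) :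
    z 0 = Real.cos (Real.pi / 4) * (R.symm z 0 + R.symm z 1) := by
  have h := (hR (R.symm z)).1
  rw [LinearIsometryEquiv.apply_symm_apply, Real.sin_pi_div_four] at h
  rw [h, Real.cos_pi_div_four]
  ring

/-- `(θ y)₀ = −y₀` on `ℝ⁴`. -/
theorem timeReflection_four_zero (y : E4) : timeReflection 4 y 0 = -y 0 := by
  simp [timeReflection_apply]

/-- `(θ y)₁ = y₁` on `ℝ⁴`. -/
theorem timeReflection_four_one (y : E4) : timeReflection 4 y 1 = y 1 := by
  simp [timeReflection_apply]

/-- Time component of the conjugate frame `M = θRθ`: `(M y)₀ = cos(π/4)·(y₀ − y₁)`. -/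
theorem conjFrame_apply_zero {R : E4 ≃ₗᵢ[ℝ] E4} (hR : IsQuarterTurnFrame R) (y : E4) :
    (((timeReflection 4).trans R).trans (timeReflection 4)) y 0 =
      Real.cos (Real.pi / 4) * (y 0 - y 1) := by
  rw [LinearIsometryEquiv.trans_apply, LinearIsometryEquiv.trans_apply, timeReflection_four_zero,
    (hR (timeReflection 4 y)).1, timeReflection_four_zero, timeReflection_four_one,
    Real.sin_pi_div_four, Real.cos_pi_div_four]
  ring

/-- The time read in the conjugate frame: `x₀ = cos(π/4)·((M⁻¹x)₀ − (M⁻¹x)₁)`. -/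
theorem conjFrame_zero_eq {R : E4 ≃ₗᵢ[ℝ] E4} (hR : IsQuarterTurnFrame R) (z : E4) :
    z 0 = Real.cos (Real.pi / 4) *
      ((((timeReflection 4).trans R).trans (timeReflection 4)).symm z 0 -
        (((timeReflection 4).trans R).trans (timeReflection 4)).symm z 1) := by
  have h := conjFrame_apply_zero hR ((((timeReflection 4).trans R).trans (timeReflection 4)).symm z)
  rwa [LinearIsometryEquiv.apply_symm_apply] at h

/-! ## Strict cone chains read in a tilted frame are time-ordered -/

/-- If the slot times of `x` are `k·(p₀ + p₁)` slotwise (`k > 0`) for a strict cone chain `p`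
(`|p₁| < p₀`, `|Δp₁| < Δp₀`), then `x` has positive, strictly increasing times. -/
theorem timeOrdered_of_cone_add {m : ℕ} {x p : Fin m → E4} {k : ℝ} (hk : 0 < k)
    (hx : ∀ i, x i 0 = k * (p i 0 + p i 1))
    (hp : (∀ i, |p i 1| < p i 0) ∧ ∀ i j, i < j → |p j 1 - p i 1| < p j 0 - p i 0) :
    (∀ i, 0 < x i 0) ∧ StrictMono fun i => x i 0 := by
  refine ⟨fun i => ?_, fun i j hij => ?_⟩
  · rw [hx i]
    have h := abs_lt.1 (hp.1 i)
    exact mul_pos hk (by linarith)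
  · show x i 0 < x j 0
    rw [hx i, hx j]
    have h := abs_lt.1 (hp.2 i j hij)
    exact mul_lt_mul_of_pos_left (by linarith) hk

/-- If the slot times of `x` are `k·(p₀ − p₁)` slotwise (`k > 0`) for a strict cone chain `p`
(`|p₁| < p₀`, `|Δp₁| < Δp₀`), then `x` has positive, strictly increasing times. -/
theorem timeOrdered_of_cone_sub {m : ℕ} {x p : Fin m → E4} {k : ℝ} (hk : 0 < k)
    (hx : ∀ i, x i 0 = k * (p i 0 - p i 1))
    (hp : (∀ i, |p i 1| < p i 0) ∧ ∀ i j, i < j → |p j 1 - p i 1| < p j 0 - p i 0) :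
    (∀ i, 0 < x i 0) ∧ StrictMono fun i => x i 0 := by
  refine ⟨fun i => ?_, fun i j hij => ?_⟩
  · rw [hx i]
    have h := abs_lt.1 (hp.1 i)
    exact mul_pos hk (by linarith)
  · show x i 0 < x j 0
    rw [hx i, hx j]
    have h := abs_lt.1 (hp.2 i j hij)
    exact mul_lt_mul_of_pos_left (by linarith) hk

/-- **(i)** A strict cone chain of the 45° frame, rotated by the quarter turn `R`, is `e₀`-time-ordered
(slot times `(x₀ + x₁)/√2`, increasing). -/
theorem isTimeOrdered_linActMulti_quarterTurn {R : E4 ≃ₗᵢ[ℝ] E4} (hR : IsQuarterTurnFrame R)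
    {m : ℕ} {G : 𝓢((Fin m → E4), ℂ)}
    (hGc : tsupport (G : (Fin m → E4) → ℂ) ⊆
      {x | (∀ i, |x i 1| < x i 0) ∧ ∀ i j, i < j → |x j 1 - x i 1| < x j 0 - x i 0}) :
    IsTimeOrdered (linActMulti R G) := fun x hx =>
  timeOrdered_of_cone_add (p := fun k => R.symm (x k)) (by rw [Real.cos_pi_div_four]; positivity)
    (fun i => quarterTurn_zero_eq hR (x i)) (hGc (mem_tsupport_linActMulti R G hx))

/-- **(ii)** A strict cone chain of the 45° frame, rotated by the conjugate frame `M = θRθ`, is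
`e₀`-time-ordered (slot times `(x₀ − x₁)/√2`, increasing). -/
theorem isTimeOrdered_linActMulti_conjFrame {R : E4 ≃ₗᵢ[ℝ] E4} (hR : IsQuarterTurnFrame R)
    {m : ℕ} {G : 𝓢((Fin m → E4), ℂ)}
    (hGc : tsupport (G : (Fin m → E4) → ℂ) ⊆
      {x | (∀ i, |x i 1| < x i 0) ∧ ∀ i j, i < j → |x j 1 - x i 1| < x j 0 - x i 0}) :
    IsTimeOrdered (linActMulti (((timeReflection 4).trans R).trans (timeReflection 4)) G) :=
  fun x hx =>
  timeOrdered_of_cone_sub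
    (p := fun k => (((timeReflection 4).trans R).trans (timeReflection 4)).symm (x k))
    (by rw [Real.cos_pi_div_four]; positivity) (fun i => conjFrame_zero_eq hR (x i))
    (hGc (mem_tsupport_linActMulti _ G hx))

/-! ## The OS adjoint and the conjugate frame -/

/-- **(iii)** `osAdjoint (M·G) = R·(osAdjoint G)` for the conjugate frame `M = θRθ` (pointwise, `θθ = 1`). -/
theorem osAdjoint_linActMulti_conjFrame (R : E4 ≃ₗᵢ[ℝ] E4) {n : ℕ} (G : 𝓢((Fin n → E4), ℂ)) :
    osAdjoint (linActMulti (((timeReflection 4).trans R).trans (timeReflection 4)) G) =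
      linActMulti R (osAdjoint G) := by
  -- adapted from `ContinuumLegGivenGap.linActMulti_osAdjoint_conj`
  ext x
  simp [linActMulti_apply, osAdjoint_apply, LinearIsometryEquiv.symm_trans, timeReflection_symm,
    timeReflection_timeReflection]

/-! ## `R` intertwines the two chain steps -/

/-- **(iv), one step**: `⟨(P x).1, R·(P x).2⟩ = Q ⟨x.1, R·x.2⟩` (`R·T_a = T_{Ra}·R`, `R·(F ⊗ G) = R·F ⊗ R·G`). -/
theorem tilt_step (R : E4 ≃ₗᵢ[ℝ] E4) (s : ℝ) (f₁ : 𝓢((Fin 1 → E4), ℂ))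
    (P Q : (Σ m : ℕ, 𝓢((Fin m → E4), ℂ)) → (Σ m : ℕ, 𝓢((Fin m → E4), ℂ)))
    (hP : P = fun Gσ => ⟨1 + (1 + Gσ.1), translateMulti (s • EuclideanSpace.single 0 1)
      ((osAdjoint f₁).appendTensor
        (f₁.appendTensor (translateMulti (s • EuclideanSpace.single 0 1) Gσ.2)))⟩)
    (hQ : Q = fun Gσ => ⟨1 + (1 + Gσ.1),
      translateMulti (s • R (EuclideanSpace.single 0 1))
        ((linActMulti R (osAdjoint f₁)).appendTensor
          ((linActMulti R f₁).appendTensor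
            (translateMulti (s • R (EuclideanSpace.single 0 1)) Gσ.2)))⟩)
    (x : Σ m : ℕ, 𝓢((Fin m → E4), ℂ)) :
    (⟨(P x).1, linActMulti R (P x).2⟩ : Σ m : ℕ, 𝓢((Fin m → E4), ℂ)) =
      Q ⟨x.1, linActMulti R x.2⟩ := by
  subst hP hQ
  simp only [linActMulti_translateMulti, LinearIsometryEquiv.map_smul, linActMulti_appendTensor]

/-- **(iv)**: `⟨(Pᴺ x).1, R·(Pᴺ x).2⟩ = Qᴺ ⟨x.1, R·x.2⟩` for every `N` and every point `x` of
`Σ m, 𝓢((ℝ⁴)^m)`. -/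
theorem tilt_iterate (R : E4 ≃ₗᵢ[ℝ] E4) (s : ℝ) (f₁ : 𝓢((Fin 1 → E4), ℂ))
    (P Q : (Σ m : ℕ, 𝓢((Fin m → E4), ℂ)) → (Σ m : ℕ, 𝓢((Fin m → E4), ℂ)))
    (hP : P = fun Gσ => ⟨1 + (1 + Gσ.1), translateMulti (s • EuclideanSpace.single 0 1)
      ((osAdjoint f₁).appendTensor
        (f₁.appendTensor (translateMulti (s • EuclideanSpace.single 0 1) Gσ.2)))⟩)
    (hQ : Q = fun Gσ => ⟨1 + (1 + Gσ.1),
      translateMulti (s • R (EuclideanSpace.single 0 1))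
        ((linActMulti R (osAdjoint f₁)).appendTensor
          ((linActMulti R f₁).appendTensor
            (translateMulti (s • R (EuclideanSpace.single 0 1)) Gσ.2)))⟩)
    (N : ℕ) (x : Σ m : ℕ, 𝓢((Fin m → E4), ℂ)) :
    (⟨(P^[N] x).1, linActMulti R (P^[N] x).2⟩ : Σ m : ℕ, 𝓢((Fin m → E4), ℂ)) =
      Q^[N] ⟨x.1, linActMulti R x.2⟩ := by
  induction N generalizing x with
  | zero => rfl
  | succ N ih =>
    rw [Function.iterate_succ_apply, Function.iterate_succ_apply, ih (P x),
      tilt_step R s f₁ P Q hP hQ x]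

/-! ## Chain moments as `e₀`-frame inner products -/

/-- `⟪Ψ_A, Ψ_{B.2}⟫ = 𝔖(ΘA* ⊗ B.2)` for a point `B` of `Σ m, 𝓢((ℝ⁴)^m)` (`inner_fieldVec_fieldVec`). -/
theorem inner_fieldVec_sigma (S : SchwingerFamily E4) (h : OSReconstructionNoE1 S.toLabelled)
    {m : ℕ} (A : 𝓢((Fin m → E4), ℂ)) (hA : IsTimeOrdered A)
    (B : Σ k : ℕ, 𝓢((Fin k → E4), ℂ)) (hB : IsTimeOrdered B.2) :
    ⟪h.fieldVec m (fun _ => ()) A hA, h.fieldVec B.1 (fun _ => ()) B.2 hB⟫_ℂ =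
      S (m + B.1) ((osAdjoint A).appendTensor B.2) := by
  rw [h.inner_fieldVec_fieldVec (fun _ => ()) (fun _ => ()) hA hB (isAppendTensorOf_appendTensor _ _)]
  rfl

/-- **Stub (TR) — READING A 45°-FRAME CHAIN WITH CONE-CHAIN ENDS IN THE `e₀` FRAME (model-blind bookkeeping).**
For the quarter-turn frame `R`, a narrow 45°-frame insertion `f₁` (only its support matters), the 45°-frame chain step
`P` (the `P` of `stub_chainGrowthDiag`) and the tilted step `Q` (of `stub_tiltedStep`): if `G` is a STRICT CONE CHAIN
of the 45° frame (`|x₁'| < x₀'`, `|Δx₁'| < Δx₀'` on its support — the dense class of `stub_density`), then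
(i) `R·G` is e₀-time-ordered (its slot times are `(x₀'+x₁')/√2`, increasing), (ii) `A := (θRθ)·G` is e₀-time-ordered
(slot times `(x₀'−x₁')/√2`), (iii) `osAdjoint A = R·(osAdjoint G)` (pointwise), (iv) `R` intertwines the two chain steps,
`⟨(P^N x).1, R·(P^N x).2⟩ = Q^N ⟨x.1, R·x.2⟩` (`R·T_a = T_{Ra}·R`, `R·(F ⊗ G) = R·F ⊗ R·G`), and hence (v) the 45°-frame
chain moment with ends `G`, `G'` is an `e₀`-FRAME inner product:
`𝔖₁(R·(ΘG* ⊗ P^N G')) = ⟪Ψ_A, Ψ_{(Q^N ⟨m', R·G'⟩).2}⟫_h` (`inner_fieldVec_fieldVec`, `fieldVec_sigma_congr`). -/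
theorem stub_tiltedChainReading :
    ∀ (S : SchwingerFamily E4) (h : OSReconstructionNoE1 S.toLabelled) (R : E4 ≃ₗᵢ[ℝ] E4),
      IsQuarterTurnFrame R →
    ∀ (u v : ℝ) (f₁ : 𝓢((Fin 1 → E4), ℂ))
      (P Q : (Σ m : ℕ, 𝓢((Fin m → E4), ℂ)) → (Σ m : ℕ, 𝓢((Fin m → E4), ℂ))),
      (P = fun Gσ => ⟨1 + (1 + Gσ.1), translateMulti ((2 * u + v) • EuclideanSpace.single 0 1)
        ((osAdjoint f₁).appendTensor
          (f₁.appendTensor (translateMulti ((2 * u + v) • EuclideanSpace.single 0 1) Gσ.2)))⟩) →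
      (Q = fun Gσ => ⟨1 + (1 + Gσ.1),
        translateMulti ((2 * u + v) • R (EuclideanSpace.single 0 1))
          ((linActMulti R (osAdjoint f₁)).appendTensor
            ((linActMulti R f₁).appendTensor
              (translateMulti ((2 * u + v) • R (EuclideanSpace.single 0 1)) Gσ.2)))⟩) →
    ∀ (m : ℕ) (G : 𝓢((Fin m → E4), ℂ)), IsTimeOrdered G →
      tsupport (G : (Fin m → E4) → ℂ) ⊆
        {x | (∀ i, |x i 1| < x i 0) ∧ ∀ i j, i < j → |x j 1 - x i 1| < x j 0 - x i 0} →
      IsTimeOrdered (linActMulti R G) ∧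
      IsTimeOrdered (linActMulti (((timeReflection 4).trans R).trans (timeReflection 4)) G) ∧
      osAdjoint (linActMulti (((timeReflection 4).trans R).trans (timeReflection 4)) G) =
        linActMulti R (osAdjoint G) ∧
      ∀ (m' : ℕ) (G' : 𝓢((Fin m' → E4), ℂ)), IsTimeOrdered G' →
        tsupport (G' : (Fin m' → E4) → ℂ) ⊆
          {x | (∀ i, |x i 1| < x i 0) ∧ ∀ i j, i < j → |x j 1 - x i 1| < x j 0 - x i 0} →
        ∀ N : ℕ,
          (⟨(P^[N] ⟨m', G'⟩).1, linActMulti R (P^[N] ⟨m', G'⟩).2⟩ : Σ m : ℕ, 𝓢((Fin m → E4), ℂ)) =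
            Q^[N] ⟨m', linActMulti R G'⟩ ∧
          ∀ (hA : IsTimeOrdered (linActMulti (((timeReflection 4).trans R).trans (timeReflection 4)) G))
            (hQ : IsTimeOrdered (Q^[N] ⟨m', linActMulti R G'⟩).2),
            S (m + (P^[N] ⟨m', G'⟩).1) (linActMulti R ((osAdjoint G).appendTensor (P^[N] ⟨m', G'⟩).2)) =
              ⟪h.fieldVec m (fun _ => ())
                  (linActMulti (((timeReflection 4).trans R).trans (timeReflection 4)) G) hA,
                h.fieldVec (Q^[N] ⟨m', linActMulti R G'⟩).1 (fun _ => ())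
                  (Q^[N] ⟨m', linActMulti R G'⟩).2 hQ⟫_ℂ := by
  intro S h R hR u v f₁ P Q hP hQ m G _hG hGc
  have hiii := osAdjoint_linActMulti_conjFrame R G
  refine ⟨isTimeOrdered_linActMulti_quarterTurn hR hGc, isTimeOrdered_linActMulti_conjFrame hR hGc, hiii,
    fun m' G' _hG' _hG'c N => ?_⟩
  have hiv : (⟨(P^[N] ⟨m', G'⟩).1, linActMulti R (P^[N] ⟨m', G'⟩).2⟩ : Σ m : ℕ, 𝓢((Fin m → E4), ℂ)) =
      Q^[N] ⟨m', linActMulti R G'⟩ :=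
    tilt_iterate R (2 * u + v) f₁ P Q hP hQ N ⟨m', G'⟩
  refine ⟨hiv, fun hA hQ' => ?_⟩
  rw [inner_fieldVec_sigma S h _ hA _ hQ', ← hiv]
  show S (m + (P^[N] ⟨m', G'⟩).1) (linActMulti R ((osAdjoint G).appendTensor (P^[N] ⟨m', G'⟩).2)) =
    S (m + (P^[N] ⟨m', G'⟩).1)
      ((osAdjoint (linActMulti (((timeReflection 4).trans R).trans (timeReflection 4)) G)).appendTensor
        (linActMulti R (P^[N] ⟨m', G'⟩).2))
  rw [linActMulti_appendTensor, hiii]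

end Summit.QuantumFields.YangMills.Theorems.CurvatureSandwichBound.Sketch

end
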